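import Summits.QuantumFields.YangMills.Theorems.WeakCouplingRatesBoxDecay

/-!
# Route `WeakCouplingRates`, crux `ColdBoxTwoPointFloorW`, stub S4 `stub_boxKernelVsLattice`: the curl part of the Hodge
# split is the `ℤ^d` curvature two-point kernel; `C(T) = T⁻⁴/π² + O(T⁻⁵)`

Helper file 5/6 (fleet seat `ym-wcr-19608-p2`, item stmt-QuantumFields-19608, line `birth`, skeleton v5).

* `curvatureTwoPoint_eq_curl_greenTensor` — **`curvatureTwoPoint p q = (d₁ div₂ g_q)(p)`** for all plaquettes of `ℤ^d`: the curl
  part of the lattice Hodge split of the point mass at `q` (`greenTensor`, `Theorems/WeakCouplingRatesDefs.lean`) IS the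
  curvature two-point kernel of `Literature/…/CurvatureGaussianField.lean` (`curvatureTwoPoint_eq_plaquetteCurl`, `plaquetteCurl_eq`);
* `curl_greenTensor_parallel` — between parallel plaquettes it is the transverse second difference `−[ΔᵢG + ΔⱼG](z)/2`;
  `curl_greenTensor_centre` — at the two central plaquettes of the box it is `curvaturePlaquetteCorr 4 T`;
* `curvaturePlaquetteCorr_eq_second_diff`, `exists_curvaturePlaquetteCorr_asymp` — **`|C(T) − T⁻⁴/π²| ≤ K/T⁵`** (`T ≥ 1`), from
  Lawler (1.37) in the tree's printed form `latticeGreen_second_diff_continuum` (`a₄ = Γ(1)/(2π²) = 1/(2π²)`, `x = −Te₀`,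
  `x₁ = x₂ = 0`).

No sorry, standard axioms; no new definition.  NOT a claim about the mass gap.
-/

set_option autoImplicit false

noncomputable section

open Finset Real
open Literature.Probability.LatticeModels
open Literature.MathematicalPhysics.QuantumLattice
open Literature.MathematicalPhysics.QuantumFieldTheory
open Literature.MathematicalPhysics.QuantumFieldTheory.LatticeMaxwell
open Literature.MathematicalPhysics.QuantumFieldTheory.AxialGauge
open Literature.MathematicalPhysics.QuantumFieldTheory.LatticeChain
open Literature.MathematicalPhysics.QuantumFieldTheory.LatticeForm (e d₁ d₂)

namespace Summit.QuantumFields.YangMills.Theorems.WeakCouplingRates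

/-! ## The curl part of the Hodge split is the `ℤ^d` curvature two-point kernel -/

/-- The inner curl of the edge Green kernel around `q` is `div₂` of the Green 2-tensor of `q`:
`Σ_b σ_b Γ(e, ∂_b q) = (div₂ g_q)(e)` (`Γ = edgeGreen`). -/
theorem plaquetteCurl_edgeGreen_eq_div₂ {d : ℕ} (q : ZdPlaquette d) (y : Site d) (k : Fin d) :
    plaquetteCurl (fun f => edgeGreen (y, k) f) q = div₂ (greenTensor ((q.1, q.2.1.1, q.2.1.2) : Plaq d)) y k := by
  obtain ⟨x, ⟨⟨i, j⟩, hij⟩⟩ := q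
  have hij' : i ≠ j := ne_of_lt hij
  rw [plaquetteCurl_eq]
  simp only [edgeGreen, div₂, greenTensor]
  -- only the summands `m = i` (when `k = j`) and `m = j` (when `k = i`) survive
  have e1 : ∀ m : Fin d, y - e m - x = y - x - Pi.single m 1 := fun m => by simp only [LatticeForm.e]; abel
  simp_rw [e1]
  by_cases hki : k = i
  · subst hki
    have hkj : ¬ k = j := hij'
    simp only [hkj, if_false, and_false, and_true, if_true, sub_zero, zero_sub]
    rw [Finset.sum_eq_single j]
    · simp only [if_true]
      have : y - (x + Pi.single j 1) = y - x - Pi.single j 1 := by abel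
      rw [this]; ring
    · intro m _ hm; simp [hm]
    · intro h; exact absurd (Finset.mem_univ j) h
  · by_cases hkj : k = j
    · subst hkj
      simp only [hki, if_false, and_false, if_true, and_true, sub_zero]
      rw [Finset.sum_eq_single i]
      · simp only [if_true]
        have : y - (x + Pi.single i 1) = y - x - Pi.single i 1 := by abel
        rw [this]; ring
      · intro m _ hm; simp [hm]
      · intro h; exact absurd (Finset.mem_univ i) h
    · simp [hki, hkj]

/-- **The curl part of the Hodge split of `δ_q` is the curvature two-point kernel**:
`curvatureTwoPoint p q = (d₁ div₂ g_q)(p)` for all plaquettes `p, q` of `ℤ^d`. -/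
theorem curvatureTwoPoint_eq_curl_greenTensor {d : ℕ} (p q : ZdPlaquette d) :
    curvatureTwoPoint p q = d₁ (div₂ (greenTensor ((q.1, q.2.1.1, q.2.1.2) : Plaq d))) p.1 p.2.1.1 p.2.1.2 := by
  rw [curvatureTwoPoint_eq_plaquetteCurl, plaquetteCurl_eq]
  simp only [plaquetteCurl_edgeGreen_eq_div₂, LatticeForm.d₁, LatticeForm.e]

/-- The curl kernel is translation invariant: `(d₁ div₂ g_{q+v})(p + v) = (d₁ div₂ g_q)(p)`. -/
theorem curl_greenTensor_shift {d : ℕ} (x y v : Site d) (i j k l : Fin d) :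
    d₁ (div₂ (greenTensor ((x + v, i, j) : Plaq d))) (y + v) k l = d₁ (div₂ (greenTensor ((x, i, j) : Plaq d))) y k l := by
  have key : ∀ z : Site d, ∀ a b : Fin d, greenTensor ((x + v, i, j) : Plaq d) (z + v) a b =
      greenTensor ((x, i, j) : Plaq d) z a b := by
    intro z a b
    simp only [greenTensor, show z + v - (x + v) = z - x by abel]
  simp only [LatticeForm.d₁, div₂]
  have e1 : ∀ m : Fin d, y + v - e m = (y - e m) + v := fun m => by abel
  have e2 : ∀ m n : Fin d, y + v + e n - e m = (y + e n - e m) + v := fun m n => by abel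
  have e3 : ∀ n : Fin d, y + v + e n = (y + e n) + v := fun n => by abel
  have e4 : ∀ m n : Fin d, y + e n + v - e m = (y + e n - e m) + v := fun m n => by abel
  simp only [e1, e3, e4, key]

/-- **`boxMaxwellPlaqCov` at the two central plaquettes against `curvaturePlaquetteCorr`**: the curl part of the Hodge
split of the point mass at `q₀ = p_c + Te₀`, evaluated at `p_c`, is `curvaturePlaquetteCorr 4 T`. -/
theorem curl_greenTensor_centre (H T : ℕ) :
    d₁ (div₂ (greenTensor (plaq12At (boxCentre H + Pi.single 0 (T : ℤ))))) (boxCentre H) 1 2 =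
      @Literature.MathematicalPhysics.QuantumFieldTheory.curvaturePlaquetteCorr 4 (by norm_num) (T : ℤ) := by
  rw [curvaturePlaquetteCorr, ← curvatureTwoPoint_shift _ _ (boxCentre H), curvatureTwoPoint_eq_curl_greenTensor]
  simp only [plaquette12, plaq12At, zero_add]
  rw [add_comm (Pi.single _ (T : ℤ)) (boxCentre H)]
  rfl

/-- `div₂` of the Green 2-tensor of `q = (x; i, j)` in the first direction of `q`:
`(div₂ g_q)(w; i) = −[G(w − eⱼ − x) − G(w − x)]/2`. -/
theorem div₂_greenTensor_fst {d : ℕ} (x w : Site d) {i j : Fin d} (hij : i ≠ j) :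
    div₂ (greenTensor ((x, i, j) : Plaq d)) w i = -(latticeGreen (w - e j - x) - latticeGreen (w - x)) / 2 := by
  simp only [div₂, greenTensor]
  rw [Finset.sum_eq_single j]
  · have h1 : ¬ (j = i ∧ i = j) := fun h => hij h.2
    simp only [h1, if_false, and_self, if_true]
    ring
  · intro m _ hm
    have h1 : ¬ (m = i ∧ i = j) := fun h => hij h.2
    simp [h1, hm]
  · intro h; exact absurd (Finset.mem_univ j) h

/-- `div₂` of the Green 2-tensor of `q = (x; i, j)` in the second direction of `q`:
`(div₂ g_q)(w; j) = [G(w − eᵢ − x) − G(w − x)]/2`. -/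
theorem div₂_greenTensor_snd {d : ℕ} (x w : Site d) {i j : Fin d} (hij : i ≠ j) :
    div₂ (greenTensor ((x, i, j) : Plaq d)) w j = (latticeGreen (w - e i - x) - latticeGreen (w - x)) / 2 := by
  simp only [div₂, greenTensor]
  rw [Finset.sum_eq_single i]
  · have h1 : ¬ (i = j ∧ j = i) := fun h => hij h.1
    simp only [h1, if_false, and_self, if_true]
    ring
  · intro m _ hm
    have h2 : ¬ (m = j ∧ j = i) := fun h => hij h.2.symm
    simp [h2, hm]
  · intro h; exact absurd (Finset.mem_univ i) h

/-- **The curl kernel between PARALLEL plaquettes is a transverse second difference of the Green function**: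
for `q = (x; i, j)`, `i ≠ j`, and the parallel plaquette at `y`, with `z = y − x`,
`(d₁ div₂ g_q)(y; i, j) = −[ΔᵢG(z) + ΔⱼG(z)]/2`, `Δ_m G(z) = G(z+e_m) + G(z−e_m) − 2G(z)`. -/
theorem curl_greenTensor_parallel {d : ℕ} (x y : Site d) {i j : Fin d} (hij : i ≠ j) :
    d₁ (div₂ (greenTensor ((x, i, j) : Plaq d))) y i j =
      -((latticeGreen (y - x + e i) + latticeGreen (y - x - e i) - 2 * latticeGreen (y - x)) +
        (latticeGreen (y - x + e j) + latticeGreen (y - x - e j) - 2 * latticeGreen (y - x))) / 2 := by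
  simp only [LatticeForm.d₁]
  rw [div₂_greenTensor_fst x y hij, div₂_greenTensor_fst x (y + e j) hij, div₂_greenTensor_snd x y hij,
    div₂_greenTensor_snd x (y + e i) hij]
  have e1 : y - e j - x = y - x - e j := by abel
  have e2 : y + e j - e j - x = y - x := by abel
  have e3 : y + e j - x = y - x + e j := by abel
  have e4 : y - e i - x = y - x - e i := by abel
  have e5 : y + e i - e i - x = y - x := by abel
  have e6 : y + e i - x = y - x + e i := by abel
  rw [e1, e2, e3, e4, e5, e6]
  ring

/-- The curvature two-point number along the axis as a transverse second difference of the Green function: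
`C(T) = −[Δ₁G + Δ₂G](−Te₀)/2`, `ΔᵢG(z) = G(z+eᵢ) + G(z−eᵢ) − 2G(z)`, `G = latticeGreen`. -/
theorem curvaturePlaquetteCorr_eq_second_diff (T : ℤ) :
    @Literature.MathematicalPhysics.QuantumFieldTheory.curvaturePlaquetteCorr 4 (by norm_num) T =
      -((latticeGreen (-(Pi.single 0 T : Site 4) + e 1) + latticeGreen (-(Pi.single 0 T : Site 4) - e 1) -
          2 * latticeGreen (-(Pi.single 0 T : Site 4))) +
        (latticeGreen (-(Pi.single 0 T : Site 4) + e 2) + latticeGreen (-(Pi.single 0 T : Site 4) - e 2) -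
          2 * latticeGreen (-(Pi.single 0 T : Site 4)))) / 2 := by
  have h0 : @Literature.MathematicalPhysics.QuantumFieldTheory.curvaturePlaquetteCorr 4 (by norm_num) T =
      d₁ (div₂ (greenTensor (((Pi.single 0 T : Site 4), (1 : Fin 4), (2 : Fin 4)) : Plaq 4))) 0 1 2 := by
    rw [curvaturePlaquetteCorr, curvatureTwoPoint_eq_curl_greenTensor]; rfl
  rw [h0, curl_greenTensor_parallel _ _ (by decide : (1 : Fin 4) ≠ 2), zero_sub]

/-! ## Asymptotics of `C(T) = curvaturePlaquetteCorr 4 T`: `C(T) = T⁻⁴/π² + O(T⁻⁵)` -/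

/-- Euclidean norm of `−T e₀`: `Σⱼ ((−T e₀)ⱼ)² = T²`. -/
theorem sum_sq_neg_single (T : ℤ) :
    ∑ j : Fin 4, (((-(Pi.single 0 T : Site 4)) j : ℤ) : ℝ) ^ 2 = (T : ℝ) ^ 2 := by
  simp [Pi.single_apply]

/-- **Asymptotics of the curvature two-point number** (from Lawler (1.37), tree `latticeGreen_second_diff_continuum`):
there is `K` with `|C(T) − T⁻⁴/π²| ≤ K/T⁵` for all `T ≥ 1`. -/
theorem exists_curvaturePlaquetteCorr_asymp : ∃ K : ℝ, 0 ≤ K ∧ ∀ T : ℕ, 1 ≤ T →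
    |@Literature.MathematicalPhysics.QuantumFieldTheory.curvaturePlaquetteCorr 4 (by norm_num) (T : ℤ) -
        1 / π ^ 2 / (T : ℝ) ^ 4| ≤ K / (T : ℝ) ^ 5 := by
  obtain ⟨K, hK0, hK⟩ := latticeGreen_second_diff_continuum (d := 4) (by norm_num)
  refine ⟨K, hK0, fun T hT => ?_⟩
  have hT0 : (0 : ℝ) < T := by exact_mod_cast hT
  set x : Site 4 := -(Pi.single 0 (T : ℤ) : Site 4) with hx
  have hx0 : x ≠ 0 := by
    intro h
    have := congrFun h 0
    simp [hx] at this
    omega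
  have hR : Real.sqrt (∑ j : Fin 4, ((x j : ℤ) : ℝ) ^ 2) = T := by
    rw [hx, sum_sq_neg_single]; push_cast; exact Real.sqrt_sq hT0.le
  have hx1 : ((x 1 : ℤ) : ℝ) = 0 := by simp [hx]
  have hx2 : ((x 2 : ℤ) : ℝ) = 0 := by simp [hx]
  have ha : Real.Gamma (((4 : ℕ) : ℝ) / 2 - 1) / (2 * π ^ (((4 : ℕ) : ℝ) / 2)) = 1 / (2 * π ^ 2) := by
    have h1 : (((4 : ℕ) : ℝ) / 2 - 1) = 1 := by norm_num
    have h2 : (((4 : ℕ) : ℝ) / 2) = ((2 : ℕ) : ℝ) := by norm_num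
    rw [h1, h2, Real.Gamma_one, Real.rpow_natCast]
  have hpow4 : (T : ℝ) ^ (-((4 : ℕ) : ℝ)) = 1 / (T : ℝ) ^ 4 := by
    rw [Real.rpow_neg hT0.le, Real.rpow_natCast, one_div]
  have hpow5 : (T : ℝ) ^ (-(((4 : ℕ) : ℝ) + 1)) = 1 / (T : ℝ) ^ 5 := by
    rw [show (-(((4 : ℕ) : ℝ) + 1)) = -((5 : ℕ) : ℝ) by norm_num, Real.rpow_neg hT0.le, Real.rpow_natCast, one_div]
  have h1 := hK x hx0 1
  have h2 := hK x hx0 2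
  rw [hR, hx1, ha, hpow4, hpow5] at h1
  rw [hR, hx2, ha, hpow4, hpow5] at h2
  have e4 : (2 - ((4 : ℕ) : ℝ)) = -2 := by norm_num
  rw [e4] at h1 h2
  simp only [ne_eq, OfNat.ofNat_ne_zero, not_false_eq_true, zero_pow, mul_zero, zero_mul, sub_zero] at h1 h2
  rw [curvaturePlaquetteCorr_eq_second_diff]
  simp only [LatticeForm.e, ← hx] at h1 h2 ⊢
  -- pure algebra: `−(A+B)/2 − 2cu = −[(A + 2cu) + (B + 2cu)]/2`
  have key : ∀ (A B u v c : ℝ), |A - c * (-2 * u)| ≤ K * v → |B - c * (-2 * u)| ≤ K * v →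
      |-(A + B) / 2 - 2 * c * u| ≤ K * v := by
    intro A B u v c hA hB
    have : -(A + B) / 2 - 2 * c * u = -((A - c * (-2 * u)) + (B - c * (-2 * u))) / 2 := by ring
    rw [this, abs_div, abs_neg, abs_two]
    linarith [abs_add_le (A - c * (-2 * u)) (B - c * (-2 * u))]
  have h := key _ _ _ _ _ h1 h2
  have e5 : 2 * (1 / (2 * π ^ 2)) * (1 / (T : ℝ) ^ 4) = 1 / π ^ 2 / (T : ℝ) ^ 4 := by
    field_simp
  have e6 : K * (1 / (T : ℝ) ^ 5) = K / (T : ℝ) ^ 5 := by ring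
  rw [e5, e6] at h
  exact h

end Summit.QuantumFields.YangMills.Theorems.WeakCouplingRates

end
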